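import Summits.Ventures.PercRepro.GenQSolidTriples

/-!
# PercRepro — the rank-`4` five-subsets of a solid, counted through its planes (night-4, gen 4)

The row (R5b) of the type-`5` LP of record (sheet §55) needs, for a solid `F` with `s` points of `G`, at least
`r₅(s) = 37, 96, 209` (`s = 8, 9, 10`) five-subsets of `F ∩ G` of rank `4`.  Every `5`-subset of `F ∩ G` has rank `3` or `4`
(lines `≤ 3` points), and the rank-`3` ones lie in the planes of `F`: `6` per `6`-point plane, `1` per `5`-point plane.
The planes are paid for by the rank-`3` triples of `F ∩ G` (each in exactly one plane; `GenQSolidTriples`):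
`16·p₆ + 7·p₅ ≤ C(s, 3)`, and the integer knapsack gives `6·p₆ + p₅ ≤ 19, 30, 43` at `s = 8, 9, 10`.

* `card_rank_three_fives_le`: `#{A ⊆ X : |A| = 5, rk A = 3} ≤ Σ_{P ∈ flatsQ M 3} C(|P ∩ X|, 5)`;
* `sum_planes_choose_five_le`: `Σ_P C(|P ∩ X|, 5) ≤ κ(|X|)` with `κ(8) = 19, κ(9) = 30, κ(10) = 43`;
* `r5` and `card_rank_four_fives_ge`: `r₅(|F ∩ G|) ≤ #{A ⊆ F ∩ G : |A| = 5, rk A = 4}`;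
* `DFq_five_ge_solids`: the row (R5b) — `DF₅ + C(n, 5) ≥ #{|G ∖ S| < 5} + i₅ + Σ_s r₅(s)·N4 s`.

Imports `GenQSolidTriples`.
-/
namespace PercRepro.Night4

open Finset ThmH SixFour GenQ PerFlat Star

variable {α : Type*} [DecidableEq α] {M : Matroid α} [M.Finite]

/-! ## The rank-`3` five-subsets of a set lie in its planes -/

/-- `#{A ⊆ X : |A| = 5, rk A = 3} ≤ Σ_{P ∈ flatsQ M 3} C(|P ∩ X|, 5)`. -/
theorem card_rank_three_fives_le {X : Finset α} (hX : X ⊆ gr M) :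
    ((X.powersetCard 5).filter (fun A : Finset α => M.eRk (A : Set α) = ((3 : ℕ) : ℕ∞))).card ≤
      ∑ P ∈ flatsQ M 3, (P ∩ X).card.choose 5 := by
  rw [card_rank_eq_eq_sum_flats hX 5 3]
  apply Finset.sum_le_sum
  intro P _
  rw [← Finset.card_powersetCard]
  exact Finset.card_filter_le _ _

/-- The rank-`3` triples of `X` are partitioned by the planes: `Σ_P #{rank-3 triples of P ∩ X} ≤ C(|X|, 3)`. -/
theorem sum_planes_rank_three_triples_le {X : Finset α} (hX : X ⊆ gr M) :
    ∑ P ∈ flatsQ M 3, (((P ∩ X).powersetCard 3).filter (fun T : Finset α => M.eRk (T : Set α) = ((3 : ℕ) : ℕ∞))).card ≤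
      X.card.choose 3 := by
  rw [← card_rank_eq_eq_sum_flats hX 3 3, ← Finset.card_powersetCard]
  exact Finset.card_filter_le _ _

/-- `κ(s)`: the integer knapsack `max 6a + b` subject to `16a + 7b ≤ C(s, 3)` — `19, 30, 43` at `s = 8, 9, 10`. -/
def kappa (s : ℕ) : ℕ := if s = 8 then 19 else if s = 9 then 30 else if s = 10 then 43 else s.choose 5

/-- **`Σ_{P ∈ flatsQ M 3} C(|P ∩ X|, 5) ≤ κ(|X|)`** when lines have `≤ 3` and planes `≤ 6` points of `X`
(`|X| ∈ {8, 9, 10}`; trivial otherwise). -/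
theorem sum_planes_choose_five_le (hs : Simple M) (hline : ∀ L ∈ flatsQ M 2, L.card ≤ 3)
    (hplane : ∀ P ∈ flatsQ M 3, P.card ≤ 6) {X : Finset α} (hX : X ⊆ gr M) (hs8 : 8 ≤ X.card)
    (hs10 : X.card ≤ 10) : ∑ P ∈ flatsQ M 3, (P ∩ X).card.choose 5 ≤ kappa X.card := by
  set a := ((flatsQ M 3).filter (fun P : Finset α => (P ∩ X).card = 6)).card with ha
  set b := ((flatsQ M 3).filter (fun P : Finset α => (P ∩ X).card = 5)).card with hb
  -- the sum is `6a + b`: every plane meets `X` in `≤ 6` points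
  have hp6 : ∀ P ∈ flatsQ M 3, (P ∩ X).card ≤ 6 :=
    fun P hP => (Finset.card_le_card Finset.inter_subset_left).trans (hplane P hP)
  have hsum : ∑ P ∈ flatsQ M 3, (P ∩ X).card.choose 5 = 6 * a + b := by
    have h6 : ∀ P ∈ flatsQ M 3, (P ∩ X).card.choose 5 =
        6 * (if (P ∩ X).card = 6 then 1 else 0) + (if (P ∩ X).card = 5 then 1 else 0) := by
      intro P hP
      have := hp6 P hP
      interval_cases h : (P ∩ X).card <;> decide
    rw [Finset.sum_congr rfl h6, Finset.sum_add_distrib, ← Finset.mul_sum]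
    rw [ha, hb, Finset.card_filter, Finset.card_filter]
  -- the triples: `16a + 7b ≤ C(|X|, 3)`
  have htr : 16 * a + 7 * b ≤ X.card.choose 3 := by
    have hge : ∀ P ∈ flatsQ M 3, 16 * (if (P ∩ X).card = 6 then 1 else 0) + 7 * (if (P ∩ X).card = 5 then 1 else 0) ≤
        (((P ∩ X).powersetCard 3).filter (fun T : Finset α => M.eRk (T : Set α) = ((3 : ℕ) : ℕ∞))).card := by
      intro P hP
      have hPX : P ∩ X ⊆ gr M := Finset.inter_subset_right.trans hX
      have h := card_rank_three_triples_ge hs hline hPX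
      by_cases h6 : (P ∩ X).card = 6
      · simp only [h6, if_true, show (6 : ℕ) ≠ 5 by norm_num, if_false]
        have := h.1 h6
        norm_num at this ⊢
        exact this
      · by_cases h5 : (P ∩ X).card = 5
        · simp only [h5, if_true, show (5 : ℕ) ≠ 6 by norm_num, if_false]
          have := h.2.1 h5
          norm_num at this ⊢
          exact this
        · simp only [h6, h5, if_false]
          exact Nat.zero_le _
    calc 16 * a + 7 * b = ∑ P ∈ flatsQ M 3, (16 * (if (P ∩ X).card = 6 then 1 else 0) +
          7 * (if (P ∩ X).card = 5 then 1 else 0)) := by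
          rw [Finset.sum_add_distrib, ← Finset.mul_sum, ← Finset.mul_sum, ha, hb, Finset.card_filter,
            Finset.card_filter]
      _ ≤ ∑ P ∈ flatsQ M 3, (((P ∩ X).powersetCard 3).filter
          (fun T : Finset α => M.eRk (T : Set α) = ((3 : ℕ) : ℕ∞))).card := Finset.sum_le_sum hge
      _ ≤ X.card.choose 3 := sum_planes_rank_three_triples_le hX
  rw [hsum]
  unfold kappa
  interval_cases h : X.card <;> simp only [Nat.choose] at htr ⊢ <;> norm_num at htr ⊢ <;> omega

/-! ## The rank-`4` five-subsets of a solid -/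

/-- `r₅(s) = C(s, 5) − κ(s)` for `s ∈ {8, 9, 10}` (`37, 96, 209`), `0` otherwise. -/
def r5 (s : ℕ) : ℕ := if s = 8 then 37 else if s = 9 then 96 else if s = 10 then 209 else 0

/-- A `5`-subset of `X ⊆ F` (`F` a solid) has rank `3` or `4` when lines have `≤ 3` points. -/
theorem choose_five_le_rank_four_add_three (hs : Simple M) (hline : ∀ L ∈ flatsQ M 2, L.card ≤ 3)
    {F X : Finset α} (hF : F ∈ flatsQ M 4) (hXF : X ⊆ F) :
    X.card.choose 5 ≤ ((X.powersetCard 5).filter (fun A : Finset α => M.eRk (A : Set α) = ((4 : ℕ) : ℕ∞))).card +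
      ((X.powersetCard 5).filter (fun A : Finset α => M.eRk (A : Set α) = ((3 : ℕ) : ℕ∞))).card := by
  have hF' := mem_flatsQ.1 hF
  have hXg : X ⊆ gr M := hXF.trans hF'.1
  rw [← Finset.card_powersetCard]
  rw [← Finset.card_union_of_disjoint (by
    rw [Finset.disjoint_filter]
    intro A _ h1 h2
    rw [h1] at h2
    exact absurd h2 (by decide))]
  apply Finset.card_le_card
  intro A hA
  rw [Finset.mem_union, Finset.mem_filter, Finset.mem_filter]
  have hA' := Finset.mem_powersetCard.1 hA
  have hr4 : M.eRk (A : Set α) ≤ ((4 : ℕ) : ℕ∞) := by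
    rw [← hF'.2.2]
    exact M.eRk_mono (Finset.coe_subset.2 (hA'.1.trans hXF))
  obtain ⟨r, hr⟩ := exists_eRk_eq_nat (M := M) A
  have hr4' : r ≤ 4 := by rw [hr] at hr4; exact_mod_cast hr4
  have hr3 : 3 ≤ r := by
    by_contra hlt
    have hle : M.eRk (A : Set α) ≤ 2 := by
      rw [hr]
      exact_mod_cast (show r ≤ 2 by omega)
    have := card_le_three_of_eRk_le_two' hs hline (hA'.1.trans hXg) hle
    omega
  rcases (show r = 4 ∨ r = 3 by omega) with h | h
  · exact Or.inl ⟨hA, by rw [hr, h]⟩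
  · exact Or.inr ⟨hA, by rw [hr, h]⟩

/-- **`r₅(|F ∩ G|) ≤ #{A ⊆ F ∩ G : |A| = 5, rk A = 4}`** for a solid `F` (lines `≤ 3`, planes `≤ 6`). -/
theorem card_rank_four_fives_ge (hs : Simple M) (hline : ∀ L ∈ flatsQ M 2, L.card ≤ 3)
    (hplane : ∀ P ∈ flatsQ M 3, P.card ≤ 6) {G F : Finset α} (hG : G ⊆ gr M) (hF : F ∈ flatsQ M 4) :
    r5 (F ∩ G).card ≤
      (((F ∩ G).powersetCard 5).filter (fun A : Finset α => M.eRk (A : Set α) = ((4 : ℕ) : ℕ∞))).card := by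
  by_cases hs8 : 8 ≤ (F ∩ G).card ∧ (F ∩ G).card ≤ 10
  · have hXg : F ∩ G ⊆ gr M := Finset.inter_subset_right.trans hG
    have h1 := choose_five_le_rank_four_add_three hs hline hF (Finset.inter_subset_left (s₂ := G))
    have h2 := card_rank_three_fives_le (M := M) hXg (X := F ∩ G)
    have h3 := sum_planes_choose_five_le hs hline hplane hXg hs8.1 hs8.2
    have h4 : (F ∩ G).card.choose 5 = kappa (F ∩ G).card + r5 (F ∩ G).card := by
      unfold kappa r5
      obtain ⟨h8, h10⟩ := hs8
      interval_cases h : (F ∩ G).card <;> decide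
    omega
  · have : r5 (F ∩ G).card = 0 := by
      unfold r5
      have : ¬ (F ∩ G).card = 8 ∧ ¬ (F ∩ G).card = 9 ∧ ¬ (F ∩ G).card = 10 := by omega
      simp only [this.1, this.2.1, this.2.2, if_false]
    rw [this]
    exact Nat.zero_le _

/-- Grouping the solids by their number of points of `G`: `Σ_F r₅(|F ∩ G|) = Σ_s r₅(s)·N4 s`. -/
theorem sum_solids_r5_eq (G : Finset α) :
    ∑ F ∈ flatsQ M 4, r5 (F ∩ G).card = ∑ s ∈ Finset.range (G.card + 1), r5 s * N4 M G s := by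
  rw [← Finset.sum_fiberwise_of_maps_to (s := flatsQ M 4) (t := Finset.range (G.card + 1))
    (g := fun F : Finset α => (F ∩ G).card) (fun F _ => Finset.mem_coe.2 (Finset.mem_range.2
      (Nat.lt_succ_of_le (Finset.card_le_card Finset.inter_subset_right))))]
  apply Finset.sum_congr rfl
  intro s _
  unfold N4
  rw [Finset.card_eq_sum_ones, Finset.mul_sum]
  apply Finset.sum_congr rfl
  intro F hF
  rw [(Finset.mem_filter.1 hF).2, mul_one]

/-- **THE ROW (R5b) of the type-`5` LP**: `DF₅ + C(n, 5) ≥ #{|G ∖ S| < 5} + i₅ + Σ_s r₅(s)·N4 s` on a rank-`q` set `G`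
of a simple matroid with lines `≤ 3` and planes `≤ 6` points. -/
theorem DFq_five_ge_solids (hs : Simple M) (hline : ∀ L ∈ flatsQ M 2, L.card ≤ 3)
    (hplane : ∀ P ∈ flatsQ M 3, P.card ≤ 6) {G : Finset α} (hG : G ⊆ gr M) (q : ℕ) :
    ((Rq M G q).filter (fun S : Finset α => (G \ S).card < 5)).card +
      ((Rq M G q).filter (fun S : Finset α => (G \ S).card = 5)).card +
      ∑ s ∈ Finset.range (G.card + 1), r5 s * N4 M G s ≤ DFq M G q 5 + G.card.choose 5 := by
  have h := DFq_add_choose_ge_of_flats (M := M) hG q 5 (by norm_num)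
  have h2 : ∑ s ∈ Finset.range (G.card + 1), r5 s * N4 M G s ≤
      ∑ F ∈ flatsQ M (5 - 1), (((F ∩ G).powersetCard 5).filter
        (fun A : Finset α => M.eRk (A : Set α) = ((5 - 1 : ℕ) : ℕ∞))).card := by
    rw [← sum_solids_r5_eq]
    apply Finset.sum_le_sum
    intro F hF
    exact card_rank_four_fives_ge hs hline hplane hG hF
  omega

end PercRepro.Night4
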